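import Mathlib.Algebra.Order.BigOperators.Group.Finset
import Mathlib.Algebra.BigOperators.Ring.Finset
import Mathlib.Data.Real.Basic
import Mathlib.Data.Fin.VecNotation
import Mathlib.Tactic.FinCases
import Mathlib.Tactic.Linarith
import Mathlib.Tactic.NormNum
import Mathlib.Tactic.Ring
import Mathlib.Tactic.LinearCombination
import Mathlib.Tactic.Positivity
import Mathlib.Tactic.FieldSimp
import Mathlib.Analysis.Real.Sqrt
import Literature.Computability.QuantumComplexity.NonlocalGameClassicalValue
import HarnessLib

/-!
# The one-step rendezvous game on cycles and on the graph ensemble `{C₃, C₆}`: classical values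
# `7/9`, `7/18` and `7/12`; Bell-pair strategies reaching `5/6`, `5/12` and beating `7/12`

Topic `Literature/Computability/QuantumComplexity`, companion of `NonlocalGameClassicalValue.lean`
(nonlocal games, `classicalValue` = the maximum over deterministic strategies, shared randomness
cannot exceed it).  Sources (both held and read at the cited lines):

* J. Tucker et al., *Quantum Nonlocal Games on Graph Ensembles*, arXiv:2606.16784v1 (2026)
  [TuckerEtAl2026] (held text `paper:arxiv-2606.16784`): p. 1 “that ensemble consists of the
  labelled graphs C3 and C6, with equal probabilities … the referee decides the graph and places
  the players on random vertices”; p. 3 “a synchronous, one-step game with the following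
  assumptions: the players may start on any site, they are not allowed to wait (they have to
  move), and they win if they end up on the same site or exchange places (meet on the way), but
  not simply by starting on the same site”, eq. (2) `P_W(Σ) = Σᵢ P(Gᵢ) P(W | Σ, Gᵢ)`, “a joint
  strategy Σ_c = (σ₁ᴬ, σ₁ᴮ, …, σₙᴬ, σₙᴮ) prescribes a list of actions σᵢᴬ and σᵢᴮ to be taken by
  Alice and Bob respectively, when they land on site i. Each action can be ‘go to the
  higher-indexed site’ (σᵢ = 1) or ‘go to the lower-indexed site’ (σᵢ = 0)”, “As the optimal
  classical strategy is always deterministic, we do not consider probabilistic strategies here”,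
  “yielding a maximum classical rendezvous probability of P_W(Σ_c^opt) ≈ 0.5833”; Methods p. 10
  eq. (6) `S(C3) = (0,0,0)` “the ‘go-to-lowest’ strategy”, eq. (7) `S(C6) = (0,0,0,1,0,0)`
  “the optimal classical strategy of go-to-lowest on all nodes except the fourth”, eq. (8)
  `S({C3,C6}) = (0,0,0,1,0,0)`, and “Optimal strategies in our games are always deterministic as
  the probability of winning is a linear function of probabilities on all nodes”; p. 8 “the
  optimal classical strategy for the ensemble is also the optimal classical strategy for the
  individual graphs”.
* P. Mironowicz, *Entangled rendezvous: a possible application of Bell non-locality for mobile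
  agents on networks*, New J. Phys. 25, 013023 (2023) = arXiv:2207.14404 [Mironowicz2023]
  (held text `paper:arxiv-2207.14404`), Table IV (parties not allowed to wait, possibly
  randomized at the same initial position `S = 1`, one step), row `S` (LHV strategies), `E = 1`:
  “Cycle 3 … 0.77778”, “Cycle 6 … 0.38889”.

HONEST FRAMING (pub-qadeq lane, CLAIMS row E-78 — two ⁸⁸Sr⁺ traps 2 m apart play the
`{C₃, C₆}` game at `P̄_W = 0.5992(8)` against the classical `0.5833`): instance-level adjudication
of specific advantage claims; no claim about BQP vs BPP or the summit.  This file certifies the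
CLASSICAL COMPARATOR of that row — `7/12`, a maximum over the `2¹²` deterministic site-label
strategies, not exceeded by shared randomness — and the single-cycle values `7/9`, `7/18` of
the earlier literature.  Section `Entangled` (v2) adds the quantum side in the source's own
model: the Bell-pair outcome statistics of its eq. (11), written in inner-product form and taken
as the definition; an explicit strategy with rational settings winning the ensemble game with
probability exactly `10311890/16943373 = 0.6086… > 7/12`; and settings at multiples of `60°`
giving exactly `5/6` on `C₃` and `5/12` on `C₆` (= the quantum values Q = M of [Mironowicz2023]
Table IV) and `29/48` on the ensemble.  The source's own optima `0.6043`, `0.6086` are numerical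
with irrational settings and are not reproduced as such.  Nothing here re-derives eq. (11) from
the Hilbert-space formalism or concerns the devices or the locality / detection assumptions of
the experiment.

## Conventions

Sites of the cycle `C_m` are `Fin m` (the sources' label `i` is our `i − 1`).  The two neighbours
of a site are `i ± 1 (mod m)`; the action `true` (“σᵢ = 1”) moves to the neighbour with the
HIGHER label, `false` to the one with the LOWER label — the sources' “higher/lower formulation”
(footnote 1 of [TuckerEtAl2026]: for a single cycle this is equivalent to moving clockwise /
anticlockwise, for an ensemble it is not, and it is the formulation the printed numbers use).
Starting vertices are independent and uniform (they may coincide); the players win iff after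
the move they occupy the same site or have exchanged sites.

## Contents (all proved, 0 named facts)

* `lowerNbr`, `higherNbr`, `move`, `win` (the rules), `cycleGame m : NonlocalGame (Fin m) (Fin m)
  Bool Bool` (uniform weight `1/m²` per ordered start pair), `winCount` and `detValue_cycleGame`
  (`P(W | Σ, C_m) = #wins / m²`).
* `winCount_three_le` (`≤ 7`), `winCount_six_le` (`≤ 14`) by exhaustion of the `2⁶` resp. `2¹²`
  deterministic strategy pairs in the kernel; the printed optimal strategies `goLowest`
  (eq. (6)) and `sigmaOpt` (eq. (7) = eq. (8)) attain them; **`classicalValue_cycleGame_three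
  = 7/9`**, **`classicalValue_cycleGame_six = 7/18`** [Mironowicz2023, Table IV].
* The ensemble: `restrict` (a site-label strategy used on the smaller graph), **`ensembleValue`**
  (eq. (2) with `P(C₃) = P(C₆) = 1/2`), **`ensembleValue_le`** (`≤ 7/12`), `ensembleValue_sigmaOpt`
  (`= 7/12`, eq. (8)), `isGreatest_ensembleValue` (the printed “maximum classical rendezvous
  probability 0.5833” = `7/12`, attained by optimal single-graph strategies simultaneously — the
  p. 8 remark), **`ensembleValue_mixed_le`** (shared randomness does not help: “the optimal
  classical strategy is always deterministic”).
* Section `Entangled` (v2): `bellGram` / `bellProb` (eq. (11)'s statistics: equal action bits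
  w.p. `(1+⟨u,v⟩)/4` each, different w.p. `(1−⟨u,v⟩)/4` each), `sum_bellGram`, `bellProb_nonneg`,
  `gramWinProb` / `entangledWinProb` / **`entangledEnsembleValue`**, `settingOpt` (rational unit
  vectors), **`entangledEnsembleValue_settingOpt = 10311890/16943373`**,
  **`entangled_beats_classical`** (`7/12 < 0.60861 < 0.60865`); hexagonal settings `hexVec k =
  (cos 60°k, sin 60°k)`: **`entangledWinProb_hex_three = 5/6`**, **`entangledWinProb_hex_six =
  5/12`**, `entangledEnsembleValue_hex = 29/48` [cite: TuckerEtAl2026, p. 3 and Supplementary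
  eq. (11); Mironowicz2023, Table IV rows Q, M].
-/

namespace Literature.Computability.QuantumComplexity

namespace Rendezvous

open Finset

/-! ## The rules -/

/-- The neighbour `i − 1 (mod m)` of site `i` (plumbing). [folklore] -/
def prevSite {m : ℕ} (i : Fin m) : Fin m := ⟨(i.val + (m - 1)) % m, Nat.mod_lt _ i.pos⟩

/-- The neighbour `i + 1 (mod m)` of site `i` (plumbing). [folklore] -/
def nextSite {m : ℕ} (i : Fin m) : Fin m := ⟨(i.val + 1) % m, Nat.mod_lt _ i.pos⟩

/-- The LOWER-indexed of the two neighbours of a site on the cycle `C_m`.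
[cite: TuckerEtAl2026, p. 3 (“go to the lower-indexed site” (σᵢ = 0))] -/
def lowerNbr {m : ℕ} (i : Fin m) : Fin m :=
  if (prevSite i).val ≤ (nextSite i).val then prevSite i else nextSite i

/-- The HIGHER-indexed of the two neighbours of a site on the cycle `C_m`.
[cite: TuckerEtAl2026, p. 3 (“go to the higher-indexed site” (σᵢ = 1))] -/
def higherNbr {m : ℕ} (i : Fin m) : Fin m :=
  if (prevSite i).val ≤ (nextSite i).val then nextSite i else prevSite i

/-- The move prescribed by the action bit: `true` = go to the higher-indexed neighbour,
`false` = go to the lower-indexed one (waiting is not allowed).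
[cite: TuckerEtAl2026, p. 3 (“they are not allowed to wait (they have to move)”, “σᵢ = 1” / “σᵢ = 0”)] -/
def move {m : ℕ} (i : Fin m) (up : Bool) : Fin m := if up then higherNbr i else lowerNbr i

/-- The winning condition of the one-step rendezvous game: after the move the players “end up on
the same site or exchange places (meet on the way), but not simply by starting on the same
site”. [cite: TuckerEtAl2026, p. 3] -/
def win {m : ℕ} (x y : Fin m) (ax ay : Bool) : Bool :=
  decide (move x ax = move y ay) || (decide (move x ax = y) && decide (move y ay = x))

/-- **The one-step rendezvous game on the labelled cycle `C_m`** as a nonlocal game: Alice is told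
her starting site `x`, Bob his starting site `y` (independent, uniform: weight `1/m²` on every
ordered pair, coincident starts allowed), each answers an action bit, and they win under `win`.
[cite: TuckerEtAl2026, p. 1 (“places the players on random vertices”) and p. 3; Mironowicz2023, Table IV setting (S = 1, no waiting, one step)] -/
noncomputable def cycleGame (m : ℕ) : NonlocalGame (Fin m) (Fin m) Bool Bool where
  prior _ _ := 1 / (m : ℝ) ^ 2
  prior_nonneg _ _ := by positivity
  win x y a b := win x y a b

/-- The number of ordered start pairs won by the deterministic strategy pair `(a, b)`.
[cite: TuckerEtAl2026, Methods p. 10 (“We build winning probability functions by mapping all potential routes from all possible starting locations”)] -/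
def winCount (m : ℕ) (a b : Fin m → Bool) : ℕ :=
  ∑ x : Fin m, ∑ y : Fin m, if win x y (a x) (b y) then 1 else 0

/-- `P(W | Σ, C_m) = #wins / m²`. [cite: TuckerEtAl2026, eq. (2) (the conditional probabilities P(W ∣ Σ, Gᵢ))] -/
theorem detValue_cycleGame {m : ℕ} (a b : Fin m → Bool) :
    (cycleGame m).detValue a b = (winCount m a b : ℝ) / (m : ℝ) ^ 2 := by
  simp only [NonlocalGame.detValue, cycleGame, winCount, Nat.cast_sum, Nat.cast_ite, Nat.cast_one,
    Nat.cast_zero]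
  simp_rw [← Finset.mul_sum]
  ring

/-! ## The cycle `C₃`: `ω_c = 7/9` -/

/-- “Go-to-lowest” on every site — eq. (6), `S(C3) = (0,0,0)`. [cite: TuckerEtAl2026, Methods eq. (6)] -/
def goLowest (m : ℕ) : Fin m → Bool := fun _ => false

/-- A strategy on three sites is the vector of its values (plumbing). [folklore] -/
private theorem eq_vec_three (a : Fin 3 → Bool) : a = ![a 0, a 1, a 2] := by
  funext i; fin_cases i <;> rfl

/-- Exhaustion over the `2⁶` deterministic strategy pairs on `C₃` (plumbing). [folklore] -/
private theorem winCount_three_le_aux :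
    ∀ a0 a1 a2 b0 b1 b2 : Bool, winCount 3 ![a0, a1, a2] ![b0, b1, b2] ≤ 7 := by
  decide

/-- On `C₃` every deterministic strategy pair wins at most `7` of the `9` start pairs.
[cite: Mironowicz2023, Table IV (row S, E = 1: Cycle 3 = 0.77778)] -/
theorem winCount_three_le (a b : Fin 3 → Bool) : winCount 3 a b ≤ 7 := by
  rw [eq_vec_three a, eq_vec_three b]
  exact winCount_three_le_aux _ _ _ _ _ _

/-- … and go-to-lowest wins exactly `7` (it loses only the start pairs `(1,3)` and `(3,1)`).
[cite: TuckerEtAl2026, Methods eq. (6)] -/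
theorem winCount_three_goLowest : winCount 3 (goLowest 3) (goLowest 3) = 7 := by
  decide

/-- **`ω_c(C₃) = 7/9`** for the one-step rendezvous game with coincident starts allowed.
[cite: Mironowicz2023, Table IV (row S, E = 1, Cycle 3: 0.77778)] -/
theorem classicalValue_cycleGame_three : (cycleGame 3).classicalValue = 7 / 9 := by
  refine le_antisymm (NonlocalGame.classicalValue_le fun a b => ?_) ?_
  · rw [detValue_cycleGame]
    have h := winCount_three_le a b
    have h' : (winCount 3 a b : ℝ) ≤ 7 := by exact_mod_cast h
    norm_num
    linarith
  · have h := (cycleGame 3).detValue_le_classicalValue (goLowest 3) (goLowest 3)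
    rw [detValue_cycleGame, winCount_three_goLowest] at h
    norm_num at h
    linarith

/-! ## The cycle `C₆`: `ω_c = 7/18` -/

/-- Eq. (7) = eq. (8): `(0,0,0,1,0,0)` — “go-to-lowest on all nodes except the fourth in which
players go to the highest-indexed node available to them”. [cite: TuckerEtAl2026, Methods eqs. (7)–(8)] -/
def sigmaOpt : Fin 6 → Bool := ![false, false, false, true, false, false]

/-- A strategy on six sites is the vector of its values (plumbing). [folklore] -/
private theorem eq_vec_six (a : Fin 6 → Bool) : a = ![a 0, a 1, a 2, a 3, a 4, a 5] := by
  funext i; fin_cases i <;> rfl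

/-- Exhaustion over the `2¹²` deterministic strategy pairs on `C₆` (plumbing). [folklore] -/
private theorem winCount_six_le_aux :
    ∀ a0 a1 a2 a3 a4 a5 b0 b1 b2 b3 b4 b5 : Bool,
      winCount 6 ![a0, a1, a2, a3, a4, a5] ![b0, b1, b2, b3, b4, b5] ≤ 14 := by
  decide +kernel

/-- On `C₆` every deterministic strategy pair wins at most `14` of the `36` start pairs.
[cite: Mironowicz2023, Table IV (row S, E = 1: Cycle 6 = 0.38889)] -/
theorem winCount_six_le (a b : Fin 6 → Bool) : winCount 6 a b ≤ 14 := by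
  rw [eq_vec_six a, eq_vec_six b]
  exact winCount_six_le_aux _ _ _ _ _ _ _ _ _ _ _ _

/-- … and the printed optimal strategy wins exactly `14`. [cite: TuckerEtAl2026, Methods eq. (7) (“represents the optimal classical strategy”)] -/
theorem winCount_six_sigmaOpt : winCount 6 sigmaOpt sigmaOpt = 14 := by
  decide

/-- **`ω_c(C₆) = 7/18`** for the one-step rendezvous game with coincident starts allowed.
[cite: Mironowicz2023, Table IV (row S, E = 1, Cycle 6: 0.38889); TuckerEtAl2026, Methods eq. (7)] -/
theorem classicalValue_cycleGame_six : (cycleGame 6).classicalValue = 7 / 18 := by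
  refine le_antisymm (NonlocalGame.classicalValue_le fun a b => ?_) ?_
  · rw [detValue_cycleGame]
    have h := winCount_six_le a b
    have h' : (winCount 6 a b : ℝ) ≤ 14 := by exact_mod_cast h
    norm_num
    linarith
  · have h := (cycleGame 6).detValue_le_classicalValue sigmaOpt sigmaOpt
    rw [detValue_cycleGame, winCount_six_sigmaOpt] at h
    norm_num at h
    linarith

/-! ## The ensemble `{C₃, C₆}` with equal probabilities: `P_W ≤ 7/12 ≈ 0.5833` -/

/-- A classical strategy for the ensemble is ONE action bit per site label `i = 1,…,6` (the player
sees only the label of the site it lands on, eq. (8): “coinciding with S(C3) and S(C6) when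
players land on the respective graphs”); on the smaller cycle `C_k` it uses its first `k` bits.
[cite: TuckerEtAl2026, Methods eq. (8) and p. 3 (“the list contains 2n binary digits”)] -/
def restrict {k n : ℕ} (h : k ≤ n) (σ : Fin n → Bool) : Fin k → Bool := fun i => σ (i.castLE h)

/-- **The figure of merit (2) for the ensemble `{C₃, C₆}` with `P(C₃) = P(C₆) = 1/2`**:
`P_W(Σ) = ½ P(W | Σ, C₃) + ½ P(W | Σ, C₆)` for the deterministic joint strategy
`Σ = (σᴬ, σᴮ)`. [cite: TuckerEtAl2026, eq. (2) and p. 1 (“C3 and C6, with equal probabilities”)] -/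
noncomputable def ensembleValue (σA σB : Fin 6 → Bool) : ℝ :=
  1 / 2 * (cycleGame 3).detValue (restrict (by decide) σA) (restrict (by decide) σB) +
    1 / 2 * (cycleGame 6).detValue σA σB

/-- **Every classical strategy for the `{C₃, C₆}` ensemble has `P_W ≤ 7/12`** (`= 0.58333…`, the
printed “maximum classical rendezvous probability … ≈ 0.5833”): the two single-graph bounds
`7/9` and `7/18` averaged. [cite: TuckerEtAl2026, p. 3 (“P_W(Σ_c^opt) ≈ 0.5833”)] -/
theorem ensembleValue_le (σA σB : Fin 6 → Bool) : ensembleValue σA σB ≤ 7 / 12 := by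
  unfold ensembleValue
  have h3 := (cycleGame 3).detValue_le_classicalValue (restrict (by decide) σA)
    (restrict (by decide) σB)
  have h6 := (cycleGame 6).detValue_le_classicalValue σA σB
  rw [classicalValue_cycleGame_three] at h3
  rw [classicalValue_cycleGame_six] at h6
  linarith

/-- The printed optimal ensemble strategy (eq. (8), both players) attains `7/12`: it is optimal on
`C₃` (its first three bits are go-to-lowest) and on `C₆` simultaneously — “the optimal classical
strategy for the ensemble is also the optimal classical strategy for the individual graphs”.
[cite: TuckerEtAl2026, Methods eq. (8) and p. 8] -/
theorem ensembleValue_sigmaOpt : ensembleValue sigmaOpt sigmaOpt = 7 / 12 := by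
  unfold ensembleValue
  have h3 : winCount 3 (restrict (by decide) sigmaOpt) (restrict (by decide) sigmaOpt) = 7 := by
    decide
  rw [detValue_cycleGame, detValue_cycleGame, h3, winCount_six_sigmaOpt]
  norm_num

/-- **The classical value of the `{C₃, C₆}` rendezvous game is `7/12`** (the maximum of `P_W` over
all `2¹²` deterministic joint strategies, attained). [cite: TuckerEtAl2026, p. 3 (“yielding a maximum classical rendezvous probability of P_W(Σ_c^opt) ≈ 0.5833”)] -/
theorem isGreatest_ensembleValue :
    IsGreatest (Set.range fun p : (Fin 6 → Bool) × (Fin 6 → Bool) => ensembleValue p.1 p.2)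
      (7 / 12) :=
  ⟨⟨(sigmaOpt, sigmaOpt), ensembleValue_sigmaOpt⟩, by
    rintro _ ⟨p, rfl⟩
    exact ensembleValue_le p.1 p.2⟩

/-- **Shared randomness does not help**: a probabilistic classical strategy for the ensemble — a
convex combination (the shared random string `i`, weights `w i ≥ 0`, `Σ w = 1`) of deterministic
joint strategies — has `P_W ≤ 7/12` (“Optimal strategies in our games are always deterministic
as the probability of winning is a linear function”). [cite: TuckerEtAl2026, Methods p. 10 and p. 3 (“As the optimal classical strategy is always deterministic, we do not consider probabilistic strategies here”)] -/
theorem ensembleValue_mixed_le {ι : Type*} (I : Finset ι) (w : ι → ℝ) (hw0 : ∀ i ∈ I, 0 ≤ w i)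
    (hw1 : ∑ i ∈ I, w i = 1) (σA σB : ι → Fin 6 → Bool) :
    ∑ i ∈ I, w i * ensembleValue (σA i) (σB i) ≤ 7 / 12 := by
  calc ∑ i ∈ I, w i * ensembleValue (σA i) (σB i)
      ≤ ∑ i ∈ I, w i * (7 / 12) :=
        sum_le_sum fun i hi => mul_le_mul_of_nonneg_left (ensembleValue_le _ _) (hw0 i hi)
    _ = 7 / 12 := by rw [← sum_mul, hw1, one_mul]

/-- The experiment's margin in these units: `0.5992 − 7/12 > 19 × 0.0008` (the source's “exceeds
the classical limit by 20 standard deviations”, with `P̄_W = 0.5992(8)`) — arithmetic only; the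
measured value itself is data, not a theorem. [cite: TuckerEtAl2026, p. 6 (“P̄_W(Σ²_q) = 0.5992(8) … exceeds the classical limit by 20 standard deviations”)] -/
theorem reported_margin : (0.5992 : ℝ) - 7 / 12 > 19 * 0.0008 := by norm_num


/-! ## The entangled strategy (v2): a Bell pair beats `7/12`, and reaches `5/6`, `5/12` on `C₃`, `C₆`

The source's quantum players “share a maximally entangled 2-qubit state … such as the Bell state
|Φ⁺⟩ = (|00⟩ + |11⟩)/√2.  After landing on their starting site, each player applies a local
unitary rotation to their qubit.  They then measure their qubit in the computational basis and go
to the higher-indexed (lower-indexed) site if the measurement outcome was 1 (0)” (p. 3), with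
`R(θ) = exp(−i θ σ_y / 2)` and final state (Supplementary eq. (11))
`R(θ_a) ⊗ R(θ_b) |ψ⟩ = 2^{−1/2} (cos((θ_b−θ_a)/2), −sin((θ_a−θ_b)/2), sin((θ_a−θ_b)/2), cos((θ_b−θ_a)/2))ᵀ`,
so the two action bits agree with probability `cos²((θ_a−θ_b)/2)` (each equal pair
`cos²((θ_a−θ_b)/2)/2`) and differ with probability `sin²((θ_a−θ_b)/2)`.  Writing the setting of
a site as the unit vector `u = (cos θ, sin θ)`, `cos²((θ_a−θ_b)/2) = (1 + ⟨u_a, u_b⟩)/2`; this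
inner-product form of the statistics is TAKEN AS THE DEFINITION below (`bellProb`, over any
field, so that the kernel can evaluate rational instances).  Results: (i) a player-symmetric
strategy with RATIONAL unit-vector settings (ours, found by a coordinate search) wins the
`{C₃, C₆}` ensemble game with probability exactly `10311890/16943373 = 0.60861…` — above the
classical `7/12 = 0.58333…` of `ensembleValue_le` and within `4·10⁻⁵` of the printed optimum
`P_W(Σ²_q) ≈ 0.6086` (the source's optima have irrational settings, `α ≈ −1.93657837`);
(ii) settings at multiples of `60°` give exactly `5/6` on `C₃` and `5/12` on `C₆`, the quantum
values of [Mironowicz2023] Table IV (rows Q = M: see-saw lower bound = NPA upper bound), and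
`29/48 = 0.60417` on the ensemble.  Nothing here re-derives eq. (11) from the Hilbert-space
formalism or concerns the devices. -/

section Entangled

variable {K : Type*} [Field K]

/-- The Euclidean inner product on `K²` (plumbing). [folklore] -/
def ip (u v : K × K) : K := u.1 * v.1 + u.2 * v.2

/-- **Outcome statistics of the Bell-pair strategy** as a function of `g = cos(θ_A − θ_B) =
⟨u_A, u_B⟩`: the action bits are `(a, b)` with probability `(1 + g)/4` if `a = b` and `(1 − g)/4`
if `a ≠ b` — eq. (11)'s `cos²((θ_A−θ_B)/2)/2` and `sin²((θ_A−θ_B)/2)/2`; taken as the definition.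
[cite: TuckerEtAl2026, Supplementary Information eq. (11) (“|ψ⟩_f = R(θ_a) ⊗ R(θ_b)|ψ⟩_i = (1/√2)(cos((θ_b−θ_a)/2), −sin((θ_a−θ_b)/2), sin((θ_a−θ_b)/2), cos((θ_b−θ_a)/2))ᵀ … R(θ) = exp(−i θ σ_y/2)”) and p. 3 (“go to the higher-indexed (lower-indexed) site if the measurement outcome was 1 (0)”)] -/
def bellGram (g : K) (a b : Bool) : K := if a = b then (1 + g) / 4 else (1 - g) / 4

/-- The statistics for unit-vector settings `u = (cos θ_A, sin θ_A)`, `v = (cos θ_B, sin θ_B)`.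
[cite: TuckerEtAl2026, Supplementary eq. (11)] -/
def bellProb (u v : K × K) (a b : Bool) : K := bellGram (ip u v) a b

/-- The four outcome probabilities sum to one (in characteristic zero). [cite: TuckerEtAl2026, Supplementary eq. (11)] -/
theorem sum_bellGram [CharZero K] (g : K) :
    bellGram g false false + bellGram g false true + bellGram g true false +
      bellGram g true true = 1 := by
  have h4 : (4 : K) ≠ 0 := by norm_num
  simp only [bellGram, if_true, Bool.false_eq_true, Bool.true_eq_false, if_false]
  field_simp
  ring

/-- `|x| ≤ 1 ↔ x² ≤ 1` over `ℚ` (plumbing). [folklore] -/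
private theorem abs_le_one_iff_sq_le_one (x : ℚ) : |x| ≤ 1 ↔ x ^ 2 ≤ 1 := by
  constructor
  · intro h
    have := abs_nonneg x
    nlinarith [abs_mul_abs_self x, sq_abs x]
  · intro h
    rw [← sq_abs] at h
    nlinarith [abs_nonneg x]

/-- … and are nonnegative for unit-vector settings (`|⟨u,v⟩| ≤ 1`, Cauchy–Schwarz in the plane;
stated over `ℚ`). [cite: TuckerEtAl2026, Supplementary eq. (11)] -/
theorem bellProb_nonneg {u v : ℚ × ℚ} (hu : ip u u = 1) (hv : ip v v = 1) (a b : Bool) :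
    0 ≤ bellProb u v a b := by
  have hcs : (ip u v) ^ 2 ≤ 1 := by
    have h : (ip u v) ^ 2 + (u.1 * v.2 - u.2 * v.1) ^ 2 = ip u u * ip v v := by
      unfold ip; ring
    nlinarith [sq_nonneg (u.1 * v.2 - u.2 * v.1)]
  have h1 : -1 ≤ ip u v ∧ ip u v ≤ 1 := abs_le.1 ((abs_le_one_iff_sq_le_one _).2 hcs)
  unfold bellProb bellGram
  split_ifs <;> linarith [h1.1, h1.2]

/-- `P(W | settings, C_m)` as a function of the matrix of setting correlations
`g(x, y) = cos(θ^A_x − θ^B_y)`: the probability of a winning action pair averaged over the `m²`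
ordered start pairs. [cite: TuckerEtAl2026, eq. (2) and Supplementary §“rendezvous” (the displayed closed forms P(W ∣ C3), P(W ∣ C6) as sums of cos² / sin² of half angle differences)] -/
def gramWinProb (m : ℕ) (g : Fin m → Fin m → K) : K :=
  (∑ x : Fin m, ∑ y : Fin m,
      ((if win x y false false then bellGram (g x y) false false else 0) +
       (if win x y false true then bellGram (g x y) false true else 0) +
       (if win x y true false then bellGram (g x y) true false else 0) +
       (if win x y true true then bellGram (g x y) true true else 0))) / (m : K) ^ 2

/-- `P(W | settings, C_m)` when Alice uses unit-vector settings `U` and Bob `V` (one per site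
label). [cite: TuckerEtAl2026, eq. (2) and p. 3 (“A quantum strategy is therefore specified by 2n rotation angles”)] -/
def entangledWinProb (m : ℕ) (U V : Fin m → K × K) : K :=
  gramWinProb m fun x y => ip (U x) (V y)

/-- Settings for the labels of the smaller cycle (plumbing, as `restrict`). [folklore] -/
def restrictSetting {k n : ℕ} (h : k ≤ n) (U : Fin n → K × K) : Fin k → K × K :=
  fun i => U (i.castLE h)

/-- **The ensemble figure of merit (2) of a Bell-pair strategy** on `{C₃, C₆}` with equal graph
probabilities: `½ P(W | C₃) + ½ P(W | C₆)`. [cite: TuckerEtAl2026, eq. (2)] -/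
def entangledEnsembleValue (U V : Fin 6 → K × K) : K :=
  1 / 2 * entangledWinProb 3 (restrictSetting (by decide) U) (restrictSetting (by decide) V) +
    1 / 2 * entangledWinProb 6 U V

/-- A player-symmetric Bell-pair strategy with RATIONAL unit-vector settings (ours, found by a
coordinate search; angles ≈ 0°, 41.1°, 108.9°, 241.9°, 331.9°, 282.7°). [folklore] -/
def settingOpt : Fin 6 → ℚ × ℚ :=
  ![(1, 0), (55 / 73, 48 / 73), (-12 / 37, 35 / 37), (-8 / 17, -15 / 17), (15 / 17, -8 / 17),
    (9 / 41, -40 / 41)]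

/-- The settings are unit vectors, i.e. genuine rotation angles `(cos θᵢ, sin θᵢ)` (“A quantum
strategy is therefore specified by 2n rotation angles”), so `bellProb_nonneg` applies.
[cite: TuckerEtAl2026, p. 3 (“A quantum strategy is therefore specified by 2n rotation angles”)] -/
theorem settingOpt_unit : ∀ i : Fin 6, ip (settingOpt i) (settingOpt i) = 1 := by
  decide +kernel

/-- **A Bell pair beats the classical bound**: the symmetric strategy `settingOpt` wins the
`{C₃, C₆}` rendezvous game with probability exactly `10311890/16943373 = 0.608609…` — above every
classical strategy's `7/12 = 0.58333…` (`ensembleValue_le`) and within `4·10⁻⁵` of the source's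
numerically optimal `P_W(Σ²_q) ≈ 0.6086`. [cite: TuckerEtAl2026, p. 3 (“P_W(Σ¹_q) ≈ 0.6043 and P_W(Σ²_q) ≈ 0.6086 … both quantum strategies outperform the optimal classical strategy”)] -/
theorem entangledEnsembleValue_settingOpt :
    entangledEnsembleValue settingOpt settingOpt = 10311890 / 16943373 := by
  decide +kernel

/-- The quantum–classical gap of the row in exact arithmetic: `7/12 < 10311890/16943373 < 0.60865`
(margin `0.0253` over the classical bound; below the printed optimum `0.6086 + 5·10⁻⁵`).
[cite: TuckerEtAl2026, p. 3] -/
theorem entangled_beats_classical :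
    (7 : ℚ) / 12 < entangledEnsembleValue settingOpt settingOpt ∧
      entangledEnsembleValue settingOpt settingOpt < 60865 / 100000 := by
  rw [entangledEnsembleValue_settingOpt]
  norm_num

/-! ### Settings at multiples of 60°: the quantum values `5/6` and `5/12` of single cycles -/

/-- `cos(k·60°)`-part of the hexagonal settings (plumbing). [folklore] -/
def hexCos : Fin 6 → ℚ := ![1, 1 / 2, -1 / 2, -1, -1 / 2, 1 / 2]

/-- `sin(k·60°)/√3` (plumbing). [folklore] -/
def hexSin : Fin 6 → ℚ := ![0, 1 / 2, 1 / 2, 0, -1 / 2, -1 / 2]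

/-- The setting `(cos(k·60°), sin(k·60°)) ∈ ℝ²`, `k = 0,…,5`. [folklore] -/
noncomputable def hexVec (k : Fin 6) : ℝ × ℝ := ((hexCos k : ℝ), (hexSin k : ℝ) * Real.sqrt 3)

/-- Correlations of hexagonal settings are the rational numbers `cos((k−k')·60°) ∈ {1, ½, −½, −1}`
(plumbing). [folklore] -/
def hexGram {m : ℕ} (κ : Fin m → Fin 6) : Fin m → Fin m → ℚ :=
  fun x y => hexCos (κ x) * hexCos (κ y) + 3 * (hexSin (κ x) * hexSin (κ y))

/-- `⟨hexVec k, hexVec k'⟩` computed over `ℚ` (plumbing). [folklore] -/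
private theorem ip_hexVec (k k' : Fin 6) :
    ip (hexVec k) (hexVec k') =
      ((hexCos k * hexCos k' + 3 * (hexSin k * hexSin k') : ℚ) : ℝ) := by
  have h3 : Real.sqrt 3 ^ 2 = 3 := Real.sq_sqrt (by norm_num)
  simp only [ip, hexVec]
  push_cast
  linear_combination ((hexSin k : ℝ) * (hexSin k' : ℝ)) * h3

/-- The hexagonal settings are unit vectors, i.e. the rotation angles `θ = k·60°`.
[cite: TuckerEtAl2026, p. 3 (“A quantum strategy is therefore specified by 2n rotation angles”)] -/
theorem hexVec_unit (k : Fin 6) : ip (hexVec k) (hexVec k) = 1 := by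
  rw [ip_hexVec]
  have h : ∀ k : Fin 6, hexCos k * hexCos k + 3 * (hexSin k * hexSin k) = 1 := by decide +kernel
  exact_mod_cast h k

/-- The win probability is a rational function of the correlations: ring homomorphisms commute
with it (plumbing). [folklore] -/
private theorem gramWinProb_map {L : Type*} [Field L] (f : K →+* L) (m : ℕ)
    (g : Fin m → Fin m → K) :
    f (gramWinProb m g) = gramWinProb m (fun x y => f (g x y)) := by
  unfold gramWinProb bellGram
  simp only [map_div₀, map_sum, map_add, map_pow, map_natCast, apply_ite f, map_zero, map_sub,
    map_one, map_ofNat]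

/-- … in particular the cast `ℚ → ℝ` (plumbing). [folklore] -/
private theorem gramWinProb_cast {m : ℕ} (g : Fin m → Fin m → ℚ) :
    gramWinProb m (fun x y => (g x y : ℝ)) = ((gramWinProb m g : ℚ) : ℝ) := by
  have h := gramWinProb_map (Rat.castHom ℝ) m g
  simp only [Rat.coe_castHom] at h
  exact h.symm

/-- With hexagonal settings `κ`, `P(W | C_m)` is the rational number `gramWinProb m (hexGram κ)`
(plumbing). [folklore] -/
private theorem entangledWinProb_hexVec {m : ℕ} (κ : Fin m → Fin 6) :
    entangledWinProb m (fun x => hexVec (κ x)) (fun x => hexVec (κ x)) =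
      ((gramWinProb m (hexGram κ) : ℚ) : ℝ) := by
  unfold entangledWinProb
  simp_rw [ip_hexVec]
  exact gramWinProb_cast (hexGram κ)

/-- **`C₃`: settings `0°, 60°, 120°` win with probability exactly `5/6`** — the quantum value of
the one-step rendezvous game on the triangle (classical `7/9`). [cite: Mironowicz2023, Table IV (E = 1, S = 1: Cycle 3, row Q = 0.83333 = row M)] -/
theorem entangledWinProb_hex_three :
    entangledWinProb 3 (fun x => hexVec (![0, 1, 2] x)) (fun x => hexVec (![0, 1, 2] x)) =
      5 / 6 := by
  rw [entangledWinProb_hexVec]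
  have h : gramWinProb 3 (hexGram ![0, 1, 2]) = 5 / 6 := by decide +kernel
  rw [h]; norm_num

/-- **`C₆`: settings `0°, 60°, 300°, 180°, 60°, 120°` win with probability exactly `5/12`** — the
quantum value of the one-step rendezvous game on the hexagon (classical `7/18`).
[cite: Mironowicz2023, Table IV (E = 1, S = 1: Cycle 6, row Q = 0.41667 = row M)] -/
theorem entangledWinProb_hex_six :
    entangledWinProb 6 (fun x => hexVec (![0, 1, 5, 3, 1, 2] x))
        (fun x => hexVec (![0, 1, 5, 3, 1, 2] x)) = 5 / 12 := by
  rw [entangledWinProb_hexVec]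
  have h : gramWinProb 6 (hexGram ![0, 1, 5, 3, 1, 2]) = 5 / 12 := by decide +kernel
  rw [h]; norm_num

/-- **Ensemble, hexagonal settings `0°, 60°, 120°, 180°, 0°, 120°`: winning probability exactly
`29/48 = 0.60417`** (cf. the source's `P_W(Σ¹_q) ≈ 0.6043`) — above the classical `7/12 = 28/48`.
[cite: TuckerEtAl2026, p. 3 (“P_W(Σ¹_q) ≈ 0.6043”)] -/
theorem entangledEnsembleValue_hex :
    entangledEnsembleValue (fun x => hexVec (![0, 1, 2, 3, 0, 2] x))
        (fun x => hexVec (![0, 1, 2, 3, 0, 2] x)) = 29 / 48 := by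
  have h3 : entangledWinProb 3
      (restrictSetting (by decide) fun x => hexVec (![0, 1, 2, 3, 0, 2] x))
      (restrictSetting (by decide) fun x => hexVec (![0, 1, 2, 3, 0, 2] x)) =
      ((gramWinProb 3 (hexGram (![0, 1, 2] : Fin 3 → Fin 6)) : ℚ) : ℝ) := by
    have e : (restrictSetting (by decide) fun x => hexVec ((![0, 1, 2, 3, 0, 2] : Fin 6 → Fin 6) x))
        = fun x : Fin 3 => hexVec ((![0, 1, 2] : Fin 3 → Fin 6) x) := by
      funext x; fin_cases x <;> rfl
    rw [e]
    exact entangledWinProb_hexVec _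
  have h6 := entangledWinProb_hexVec (m := 6) ![0, 1, 2, 3, 0, 2]
  have v3 : gramWinProb 3 (hexGram (![0, 1, 2] : Fin 3 → Fin 6)) = 5 / 6 := by decide +kernel
  have v6 : gramWinProb 6 (hexGram (![0, 1, 2, 3, 0, 2] : Fin 6 → Fin 6)) = 3 / 8 := by
    decide +kernel
  unfold entangledEnsembleValue
  rw [h3, h6, v3, v6]
  norm_num

end Entangled

end Rendezvous

end Literature.Computability.QuantumComplexity
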